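import Mathlib
import HarnessLib
import HarnessLib.Audit
import Summits.HodgeConjecture.HodgeConjecture.Theses.KleimanBFSeeds
import Summits.HodgeConjecture.HodgeConjecture.Theses.DoublyPolarisedTransport
import Summits.HodgeConjecture.HodgeConjecture.Theorems.DoublyPolarisedSimilarAnchorsOfTwistedCube
import Summits.HodgeConjecture.HodgeConjecture.Theorems.KleimanBFSeedsWeilSimilarTrans
import Summits.HodgeConjecture.HodgeConjecture.Theorems.KleimanBFSeedsKleimanSemiregularAnchorReductions
import Summits.HodgeConjecture.HodgeConjecture.Theorems.KleimanBFSeedsWeilSixfoldsOfKleimanCAnchors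
import Summits.HodgeConjecture.HodgeConjecture.Theorems.KleimanBFSeedsWeilSixfoldsOfTwistNormalisedCAnchors
import Summits.HodgeConjecture.HodgeConjecture.Theorems.Ring2AbelianAllWeilSimilarDiscriminant
import Literature.AlgebraicGeometry.Motives.WeilSimilar
import Literature.AlgebraicGeometry.HodgeTheory.WeilClassesBFSheafSeedAt
import Literature.AlgebraicGeometry.HodgeTheory.ChernCharacterBettiTwistNormalised

/-!
# Skeleton `Lines/chosen-anchor` for crux `TwistNormalisedKleimanSemiregularAnchor` (K2ᵀ, stmt-HodgeConjecture-28148)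

HONEST FRAMING: a crux PROOF SKELETON (cruxes-workfile class), not a proof. It contains exactly TWO
`sorry`s, inside the two declared stubs `stub_good` (the load-bearing ∃-core of K2ᵀ) and
`stub_rung_CMclass_d3` (the T3 plan-only first rung `KleimanAnchorRungCM 3`); every other declaration is
sorry-free and uses tree theorems only. Nothing here proves K2ᵀ, the rung, `WeilSixfolds` (rung H2),
HC_AV, HC_CM or HC; typed ≠ proved.

PROVENANCE (director-hodge req-165 (b) = R3 of R19.712; ideator seat hodge-idea-1 g9, 2026-08-31): this is
the RE-REGISTRATION on the new deciding item 28148 of the registered line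
`Cruxes/KleimanSemiregularAnchor/Lines/chosen_anchor.lean` (v3, crux 25931, stubs `stub_good` /
`stub_trans` / `stub_supply`, the last two discharged by name), with the one change the rev-9/10 re-typing
of the route demands: every statement is RESTRICTED to Chern characters `C` that are twist-normalised
(`ChernCharacterBetti.IsTwistNormalised`, p782779) AND carry Kleiman's normal form
(`ChernCharacterBetti.KleimanChernNormalForm`, p610489) — exactly the `C` at which the route's deciding
theorem `Theses.KleimanBFSeeds.closes` (rev 9 = p811893's term) applies K2ᵀ. The v3 signature
`GoodAnchorPerDiscriminantClass` (∀ C) implies the new `GoodAnchorPerDiscriminantClassT` by restriction.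

CONTENTS.
* `MemberwiseAt C d` — the body of K2ᵀ at one `(C, d)` (verbatim; `twistNormalisedKleimanSemiregularAnchor_iff`
  is `Iff.rfl`).
* `GoodAnchorInCellAt C d δ` / `GoodAnchorPerClassAt C d` — ONE `(3, d)` anchor in the non-split cell `δ`
  (non-degenerate discriminant witness of class `δ` at `h(e, a)`, hyperbolic `h(e′, a′)`, `w` a non-zero rational
  Hodge Weil class) AT WHICH class designs upgrade to Buchweitz–Flenner sheaf seeds
  (`HasWeilClassDesignAt C 3 P h w → HasBFSheafSeedAt C 3 P h w`) — verbatim the hypothesis shape of the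
  landed pointwise certificate `Theorems.kleimanSemiregularAnchorAt_of_goodAnchorPerDiscriminantClassAt` (p811808).
* `GoodAnchorPerDiscriminantClassT` — the REGISTERED SIGNATURE of `stub_good`: the per-class statement for every
  twist-normalised Kleiman `C` and every `d ≥ 1`.
* `KleimanAnchorRungCM d` — THE RUNG of R13.61 (ii) / J r1 T3 recipe: K2ᵀ restricted to the discriminant `d`
  (the members concerned are exactly the non-hyperbolic `√−d` sixfold members, each Weil-similar — X2
  `doublyPolarisedSimilarAnchors_holds` + Landherr — to the CM anchor `(E₀³ × Ē₀³, h_b)` of its cell,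
  `h_b = θ₁ + b·θ₂`, `b ∉ Nm ℚ(√−d)ˣ`); `stub_rung_CMclass_d3 : KleimanAnchorRungCM 3` is the ℚ(√−3) = ℚ(ω) slice.
  PROVED certificates: `rung_of_twistNormalisedKleimanSemiregularAnchor : K2ᵀ → KleimanAnchorRungCM 3`,
  `rung_of_kleimanSemiregularAnchor : KleimanSemiregularAnchor → KleimanAnchorRungCM 3` (from the settled edge
  25931), `kleimanAnchorRungCM_of_goodAnchorPerClassAt` (pointwise Landherr, the d-slice of p811808 §1).
* ONE OBJECT SERVES EVERY CELL (new, proved): `HasPureWeilSeedAt C P w` — on every model of `P` an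
  `I`-semiregular (`3 ∈ I`) finite locally free sheaf with `C`-ch₃ `= N·w`, `N ≠ 0`, PURE WEIL (no `h³` term)
  and `C`-chₚ `= 0` for `p ∈ I ∖ {3}` — gives `HasBFSheafSeedAt C 3 P h w` for EVERY class `h`
  (`hasBFSheafSeedAt_of_hasPureWeilSeedAt`: take `q = 0`, `c = 0`); on a twisted square `T × T`
  (`T` any abelian threefold with `φ ≫ φ = −d`, `Φ = φ × (−φ)`; first candidate the CM cube `T = E₀³`,
  `exists_twistedCMCube`) the weight-`m` Segre classes realise EVERY non-split class `[−m]` and the weight-`1`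
  class is hyperbolic (`exists_hasWeilDiscriminantNondeg_twistedSquare`, van Geemen 5.2–5.4), so
  `PureWeilSeedOnTwistedSquare C d → GoodAnchorPerClassAt C d` (`goodAnchorPerClassAt_of_pureWeilSeedOnTwistedSquare`)
  and hence `kleimanAnchorRungCM_of_pureWeilSeedOnTwistedSquare` /
  `goodAnchorPerDiscriminantClassT_of_pureWeilSeedOnTwistedSquare`: ONE Ω²-semiregular C-evaluable sheaf with
  pure-Weil `ch₃` on ONE Weil sixfold `T × T` per `d` decides the whole `d`-slice of K2ᵀ (all cells at once).
* Composition `TwistNormalisedKleimanSemiregularAnchor_of` (kernel-checked, sorry-cone = `stub_good` only):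
  the stub gives the crux BY NAME (pointwise Landherr; interchangeable with p811808's
  `kleimanSemiregularAnchorAt_of_goodAnchorPerDiscriminantClassAt`).

References: [vanGeemen1994HodgeAV] 4.14, Lemma 5.2, 5.3–5.4; [Landherr1936HermitianForms];
[BuchweitzFlenner2003 = arXiv:math/9912245] §5 Thm. 5.1; [Markman2025 = arXiv:1805.11574] (floor);
[Markman arXiv:2509.23403] Lemma 11.3 (instrument column ev_E); [Fulton1998] Example 15.3.2;
[Kleiman1969Grassmannians, doi:10.1007/BF02684605] §5; [Hirzebruch1966] §4.2 (twist normalisation);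
[arXiv:2603.20268] §1 (non-split Weil sixfolds open).
-/

-- every declaration of this problem lives in `Summit.HodgeConjecture.HodgeConjecture.…` (summit = sub-problem)
set_option linter.dupNamespace false

noncomputable section

open CategoryTheory
open Literature.AlgebraicGeometry.Motives
open Literature.AlgebraicGeometry.HodgeTheory
open Literature.AlgebraicGeometry.VanGeemen1994
open Summit.HodgeConjecture.HodgeConjecture.Ring2.AbelianAll

namespace Summit.HodgeConjecture.HodgeConjecture.Cruxes.TwistNormalisedKleimanSemiregularAnchor.ChosenAnchor

/-! ### §0 The statements -/

/-- **K2ᵀ at one `(C, d)`** (member-wise body, VERBATIM the route decl under its binders `C`, twist-normalised,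
Kleiman, `d`, `0 < d`): every non-hyperbolic `√−d` Weil sixfold member `(A, φ)` carrying a non-zero Hodge Weil
class has a doubly-polarised anchor `(P, ψ₀, h(e,a) non-hyperbolic, h(e′,a′) hyperbolic, w)` Weil-similar to it
at which class designs upgrade to Buchweitz–Flenner sheaf seeds. [cite: BuchweitzFlenner2003, §5 Thm. 5.1] -/
def MemberwiseAt (C : ChernCharacterBetti) (d : ℕ) : Prop :=
  ∀ (A : AbelianVariety ℂ) (φ : A ⟶ A), A.dim = 2 * 3 → φ ≫ φ = -(d • 𝟙 A) →
    (∀ (e : ProjectiveEmbedding A.X) (a : complexBetti (projectiveSpace e.n ℂ) 2), IsRationalClass a → a ≠ 0 →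
      ¬ IsHyperbolicWeilType A φ 3
        ((d : ℂ) • complexBetti.map e.ι 2 a + complexBetti.map φ.hom.hom.hom 2 (complexBetti.map e.ι 2 a))) →
    (∃ wA : complexBetti A.X (2 * 3), wA ∈ weilClassesOf A φ 3 d ∧ wA ≠ 0 ∧
      IsOfHodgeType (2 * 3) A.X (2 * 3) 3 3 wA) →
    ∃ (eA : ProjectiveEmbedding A.X) (aA : complexBetti (projectiveSpace eA.n ℂ) 2) (P : AbelianVariety ℂ)
      (ψ₀ : P ⟶ P) (e e' : ProjectiveEmbedding P.X) (a : complexBetti (projectiveSpace e.n ℂ) 2)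
      (a' : complexBetti (projectiveSpace e'.n ℂ) 2) (w : complexBetti P.X (2 * 3)),
      IsRationalClass aA ∧ aA ≠ 0 ∧ P.dim = 2 * 3 ∧ ψ₀ ≫ ψ₀ = -(d • 𝟙 P) ∧ IsRationalClass a ∧ a ≠ 0 ∧
      IsRationalClass a' ∧ a' ≠ 0 ∧ w ∈ weilClassesOf P ψ₀ 3 d ∧ IsRationalClass w ∧ w ≠ 0 ∧
      IsOfHodgeType (2 * 3) P.X (2 * 3) 3 3 w ∧
      IsHyperbolicWeilType P ψ₀ 3
        ((d : ℂ) • complexBetti.map e'.ι 2 a' + complexBetti.map ψ₀.hom.hom.hom 2 (complexBetti.map e'.ι 2 a')) ∧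
      ¬ IsHyperbolicWeilType P ψ₀ 3
        ((d : ℂ) • complexBetti.map e.ι 2 a + complexBetti.map ψ₀.hom.hom.hom 2 (complexBetti.map e.ι 2 a)) ∧
      (HasWeilClassDesignAt C 3 P
          ((d : ℂ) • complexBetti.map e.ι 2 a + complexBetti.map ψ₀.hom.hom.hom 2 (complexBetti.map e.ι 2 a)) w →
        HasBFSheafSeedAt C 3 P
          ((d : ℂ) • complexBetti.map e.ι 2 a + complexBetti.map ψ₀.hom.hom.hom 2 (complexBetti.map e.ι 2 a)) w) ∧
      IsWeilSimilar 3 P ψ₀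
        ((d : ℂ) • complexBetti.map e.ι 2 a + complexBetti.map ψ₀.hom.hom.hom 2 (complexBetti.map e.ι 2 a)) A φ
        ((d : ℂ) • complexBetti.map eA.ι 2 aA + complexBetti.map φ.hom.hom.hom 2 (complexBetti.map eA.ι 2 aA))

/-- Guard: the route decl K2ᵀ is LITERALLY `∀ C, twist-normalised → Kleiman → ∀ d > 0, MemberwiseAt C d`
(`Iff.rfl`). [folklore] -/
theorem twistNormalisedKleimanSemiregularAnchor_iff :
    Summit.HodgeConjecture.HodgeConjecture.Theses.KleimanBFSeeds.TwistNormalisedKleimanSemiregularAnchor ↔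
      ∀ C : ChernCharacterBetti, C.IsTwistNormalised → C.KleimanChernNormalForm → ∀ d : ℕ, 0 < d →
        MemberwiseAt C d :=
  Iff.rfl

/-- **One good anchor in the cell `δ`** (for `C`, `d`): a `(3, d)` anchor `(P, ψ₀, e, e′, a, a′, w)` — `dim P = 6`,
`ψ₀² = −d`, `a`, `a′` rational `≠ 0`, `w` a non-zero rational `(3,3)` Weil class, `ψ₀` hyperbolic at `h(e′, a′)`,
`h(e, a)` carrying a non-degenerate discriminant witness of class `δ` — at which every class-level design upgrades
to a Buchweitz–Flenner sheaf seed. VERBATIM the hypothesis shape of the landed pointwise certificate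
`Theorems.kleimanSemiregularAnchorAt_of_goodAnchorPerDiscriminantClassAt` (p811808) at `(d, δ)`.
[cite: vanGeemen1994HodgeAV, 4.14 and Lemma 5.2] -/
def GoodAnchorInCellAt (C : ChernCharacterBetti) (d : ℕ) (δ : weilNormResidueGroup d) : Prop :=
  ∃ (P : AbelianVariety ℂ) (ψ₀ : P ⟶ P) (e e' : ProjectiveEmbedding P.X)
    (a : complexBetti (projectiveSpace e.n ℂ) 2) (a' : complexBetti (projectiveSpace e'.n ℂ) 2)
    (w : complexBetti P.X (2 * 3)),
    P.dim = 2 * 3 ∧ ψ₀ ≫ ψ₀ = -(d • 𝟙 P) ∧ IsRationalClass a ∧ a ≠ 0 ∧ IsRationalClass a' ∧ a' ≠ 0 ∧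
    w ∈ weilClassesOf P ψ₀ 3 d ∧ IsRationalClass w ∧ w ≠ 0 ∧ IsOfHodgeType (2 * 3) P.X (2 * 3) 3 3 w ∧
    IsHyperbolicWeilType P ψ₀ 3
      ((d : ℂ) • complexBetti.map e'.ι 2 a' + complexBetti.map ψ₀.hom.hom.hom 2 (complexBetti.map e'.ι 2 a')) ∧
    HasWeilDiscriminantNondeg P ψ₀ 3 d
      ((d : ℂ) • complexBetti.map e.ι 2 a + complexBetti.map ψ₀.hom.hom.hom 2 (complexBetti.map e.ι 2 a)) δ ∧
    (HasWeilClassDesignAt C 3 P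
        ((d : ℂ) • complexBetti.map e.ι 2 a + complexBetti.map ψ₀.hom.hom.hom 2 (complexBetti.map e.ι 2 a)) w →
      HasBFSheafSeedAt C 3 P
        ((d : ℂ) • complexBetti.map e.ι 2 a + complexBetti.map ψ₀.hom.hom.hom 2 (complexBetti.map e.ι 2 a)) w)

/-- **One good anchor per non-split cell** (for `C`, `d`): for every norm-residue class `δ ∈ ℚˣ/Nm(ℚ(√−d)ˣ)` of
sign `(−1)³` other than the split class `[(−1)³]`, `GoodAnchorInCellAt C d δ`.
[cite: vanGeemen1994HodgeAV, 5.3–5.4] [cite: Landherr1936HermitianForms] -/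
def GoodAnchorPerClassAt (C : ChernCharacterBetti) (d : ℕ) : Prop :=
  ∀ δ : weilNormResidueGroup d,
    Summit.HodgeConjecture.HodgeConjecture.Ring2.AbelianAll.weilSign d δ = (-1) ^ 3 →
    δ ≠ QuotientGroup.mk ((-1 : ℚˣ) ^ 3) → GoodAnchorInCellAt C d δ

/-- **Registered signature of `stub_good`** (the ∃-core of K2ᵀ; v3 of crux 25931 restricted to twist-normalised
Kleiman `C`): for every Chern character `C` that is twist-normalised and has Kleiman's normal form, every `d ≥ 1`
and every non-split cell, one good anchor. [cite: BuchweitzFlenner2003, §5 Thm. 5.1]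
[cite: vanGeemen1994HodgeAV, 5.3–5.4] -/
def GoodAnchorPerDiscriminantClassT : Prop :=
  ∀ C : ChernCharacterBetti, C.IsTwistNormalised → C.KleimanChernNormalForm → ∀ d : ℕ, 0 < d →
    GoodAnchorPerClassAt C d

/-- **THE RUNG `KleimanAnchorRungCM d`** (R13.61 (ii); J r1 T3 recipe «K2 ↾ d, members Weil-similar to
(E_ω³ × Ē_ω³, h_b non-split, h′ split, w_im)»): K2ᵀ RESTRICTED TO THE DISCRIMINANT `d` — for every
twist-normalised Kleiman `C`, the member-wise statement `MemberwiseAt C d`. The members concerned are the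
non-hyperbolic `√−d` Weil sixfolds; by X2 (`doublyPolarisedSimilarAnchors_holds`, p602146) and Landherr each of
them is Weil-similar to the CM anchor `(E₀³ × Ē₀³, Φ, h_b)` of its cell (`h_b = θ₁ + b·θ₂`, class `[−b]`,
`b ∉ Nm ℚ(√−d)ˣ`), so this is K2ᵀ on the union of the CM-anchored cells of discriminant `d` = all non-split
`√−d` cells. `d = 3` (`ℚ(√−3) = ℚ(ω)`, anchor `E_ω³ × Ē_ω³`) is the first rung `stub_rung_CMclass_d3`.
[cite: vanGeemen1994HodgeAV, 5.3–5.4] [cite: BuchweitzFlenner2003, §5 Thm. 5.1] -/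
def KleimanAnchorRungCM (d : ℕ) : Prop :=
  ∀ C : ChernCharacterBetti, C.IsTwistNormalised → C.KleimanChernNormalForm → 0 < d → MemberwiseAt C d

/-- **A pure-Weil semiregular seed at `(C, P, w)`** (the cell-uniform object): on every model `X₀ ≅ P.X` an index
set `I ∋ 3`, an `I`-semiregular (`IsISemiregular · {q' | q' + 1 ∈ I}` — for `I = {3}`: `σ₂ : Ext²(E₀,E₀) →
H⁴(X₀, Ω²)` injective, target dimension `h^{2,4} = 225` on an abelian sixfold) finite locally free `E₀` with
`C`-`ch₃(E₀) ↦ N·w`, `N ≠ 0` (NO `h³` term) and `C`-`chₚ(E₀) = 0` for `p ∈ I ∖ {3}`. No polarisation enters.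
[cite: BuchweitzFlenner2003, §5 (I-semiregular) and Thm. 5.1] -/
def HasPureWeilSeedAt (C : ChernCharacterBetti) (P : AbelianVariety ℂ) (w : complexBetti P.X (2 * 3)) : Prop :=
  ∀ (X₀ : SchemeOver ℂ) (eX : P.X ≅ X₀), ∃ (I : Finset ℕ) (E₀ : X₀.left.Modules)
    (hE₀ : IsFiniteLocallyFree E₀) (N : ℚ), 3 ∈ I ∧ N ≠ 0 ∧ IsISemiregular hE₀ {q' | q' + 1 ∈ I} ∧
    complexBetti.map eX.hom (2 * 3) (C.ch X₀ E₀ 3) = ((N : ℚ) : ℂ) • w ∧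
    ∀ p' ∈ I, p' ≠ 3 → C.ch X₀ E₀ p' = 0

/-- **One object for the whole `d`-slice** (for `C`, `d`): SOME twisted square `T × T` — `T` an abelian threefold
with `φ ≫ φ = −d`, `Φ = φ × (−φ)` (first candidate the CM cube `T = E₀³`, `exists_twistedCMCube`; also `T = B`
a `(2,1)` threefold, giving the sister cell's `B × B̄`) — with a non-zero rational Weil class `w` carrying a
pure-Weil semiregular seed `HasPureWeilSeedAt C (T × T) w`. [cite: vanGeemen1994HodgeAV, 5.3]
[cite: Schoen1998HodgeWeilAddendum, §10] -/
def PureWeilSeedOnTwistedSquare (C : ChernCharacterBetti) (d : ℕ) : Prop :=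
  ∃ (T : AbelianVariety ℂ) (φ : T ⟶ T) (w : complexBetti (T.prod T).X (2 * 3)),
    T.dim = 2 + 1 ∧ φ ≫ φ = -(d • 𝟙 T) ∧
    w ∈ weilClassesOf (T.prod T)
      (AbelianVariety.prodLift (AbelianVariety.fst T T ≫ φ) (AbelianVariety.snd T T ≫ (-φ))) 3 d ∧
    IsRationalClass w ∧ w ≠ 0 ∧ HasPureWeilSeedAt C (T.prod T) w

/-! ### §1 Pointwise Landherr: one good anchor per cell ⟹ the member-wise statement (the `d`-slice of p811808 §1) -/

/-- **`GoodAnchorPerClassAt C d ⟹ MemberwiseAt C d`**: the member's discriminant class `δ` at a Segre class has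
sign `(−1)³` and is not split (else the member would be hyperbolic there); the good anchor of class `δ` is not
hyperbolic at `h(e, a)` and is Weil-similar to the member by Landherr. The `d`-pointwise form of
`Theorems.kleimanSemiregularAnchorAt_of_goodAnchorPerDiscriminantClassAt` (p811808), same proof.
[cite: vanGeemen1994HodgeAV, 4.14, Lemma 5.2 (1)–(4), 5.3–5.4] [cite: Landherr1936HermitianForms] -/
theorem memberwiseAt_of_goodAnchorPerClassAt (C : ChernCharacterBetti) {d : ℕ} (hd : 0 < d)
    (hgood : GoodAnchorPerClassAt C d) : MemberwiseAt C d := by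
  intro A φ hA hφ hns hwA
  obtain ⟨wA, hwA, hwA0, hwAH⟩ := hwA
  have n3 : (0 : ℕ) < 3 := by norm_num
  have hW' : IsWeilType A φ 3 d := isWeilType_of_weilClass_ne_zero n3 hd hA hφ hwA hwA0 hwAH
  obtain ⟨eA, aA, haA, haA0, -⟩ := exists_weightedSegreEmbedding_self_prod A
  obtain ⟨δ, hδA, hsign⟩ := exists_hasWeilDiscriminantNondeg_weilSign hW' eA haA haA0
  have hne : δ ≠ QuotientGroup.mk ((-1 : ℚˣ) ^ 3) := by
    rintro rfl
    obtain ⟨-, e, a, ha, ha0, hh⟩ :=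
      Literature.AlgebraicGeometry.VanGeemen1994.IsWeilType.isSplitWeilType_of_hasWeilDiscriminantNondeg_split
        hW' eA haA haA0 hδA
    exact hns e a ha ha0 hh
  obtain ⟨P, ψ₀, e, e', a, a', w, hP, hψ, ha, ha0, ha', ha'0, hwW, hwrat, hw0, hwH, hhyp, hN, hup⟩ :=
    hgood δ hsign hne
  have hWP : IsWeilType P ψ₀ 3 d := isWeilType_of_weilClass_ne_zero n3 hd hP hψ hwW hw0 hwH
  have hnot := not_isHyperbolicWeilType_of_hasWeilDiscriminantNondeg_ne n3 hP hd hψ e ha ha0 hN hne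
  have hsim := isWeilSimilar_of_hasWeilDiscriminantNondeg hWP hW' e ha ha0 eA haA haA0 hN hδA
  exact ⟨eA, aA, P, ψ₀, e, e', a, a', w, haA, haA0, hP, hψ, ha, ha0, ha', ha'0, hwW, hwrat, hw0, hwH, hhyp,
    hnot, hup, hsim⟩

/-- **The rung from one good anchor per `√−d` cell** (for every twist-normalised Kleiman `C`).
[cite: vanGeemen1994HodgeAV, 5.3–5.4] -/
theorem kleimanAnchorRungCM_of_goodAnchorPerClassAt {d : ℕ}
    (h : ∀ C : ChernCharacterBetti, C.IsTwistNormalised → C.KleimanChernNormalForm → GoodAnchorPerClassAt C d) :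
    KleimanAnchorRungCM d :=
  fun C hT hK hd => memberwiseAt_of_goodAnchorPerClassAt C hd (h C hT hK)

/-- The registered stub statement gives every rung (in particular `KleimanAnchorRungCM 3`).
[cite: vanGeemen1994HodgeAV, 5.3–5.4] -/
theorem kleimanAnchorRungCM_of_goodAnchorPerDiscriminantClassT (h : GoodAnchorPerDiscriminantClassT) (d : ℕ) :
    KleimanAnchorRungCM d :=
  fun C hT hK hd => memberwiseAt_of_goodAnchorPerClassAt C hd (h C hT hK d hd)

/-- **PROVED certificate `rung_of_…` (J r1 T3 recipe): the crux K2ᵀ gives the rung** — restriction to `d = 3`.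
[cite: BuchweitzFlenner2003, §5 Thm. 5.1] -/
theorem rung_of_twistNormalisedKleimanSemiregularAnchor
    (k2T : Summit.HodgeConjecture.HodgeConjecture.Theses.KleimanBFSeeds.TwistNormalisedKleimanSemiregularAnchor) :
    KleimanAnchorRungCM 3 :=
  fun C hT hK hd => k2T C hT hK 3 hd

/-- The settled edge 25931 (`KleimanSemiregularAnchor`, ∀ C) also gives the rung (it gives K2ᵀ:
`Theorems.kleimanSemiregularAnchorAt_twistNormalisedC_of_kleimanSemiregularAnchor`, p811893).
[cite: BuchweitzFlenner2003, §5 Thm. 5.1] -/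
theorem rung_of_kleimanSemiregularAnchor
    (k2 : Summit.HodgeConjecture.HodgeConjecture.Theses.KleimanBFSeeds.KleimanSemiregularAnchor) :
    KleimanAnchorRungCM 3 :=
  fun C _ _ hd => k2 C 3 hd

/-! ### §2 One object serves every cell: pure-Weil semiregular seeds on a twisted square -/

/-- **A pure-Weil semiregular seed is a Buchweitz–Flenner sheaf seed at EVERY class `h`** (`q = 0`, `c = 0` in
`HasBFSheafSeedAt`). [cite: BuchweitzFlenner2003, §5 Thm. 5.1] -/
theorem hasBFSheafSeedAt_of_hasPureWeilSeedAt (C : ChernCharacterBetti) (P : AbelianVariety ℂ)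
    (w : complexBetti P.X (2 * 3)) (hseed : HasPureWeilSeedAt C P w) (h : complexBetti P.X 2) :
    HasBFSheafSeedAt C 3 P h w := by
  intro X₀ eX
  obtain ⟨I, E₀, hE₀, N, h3, hN, hsr, hch3, hchp⟩ := hseed X₀ eX
  refine ⟨I, E₀, hE₀, 0, N, fun _ => 0, h3, hN, hsr, ?_, ?_⟩
  · simp only [hch3, Rat.cast_zero, zero_smul, zero_add]
  · intro p' hp' hp'3
    simp only [hchp p' hp' hp'3, map_zero, Rat.cast_zero, zero_smul]

/-- CM cubes exist for every `d ≥ 1`: `T = E₀³`, `E₀ = ℂ/(ℤ + ℤ√−d)`, with the diagonal `φ_T`, `φ_T² = −d`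
(the first candidate `T` of `PureWeilSeedOnTwistedSquare`; for `d = 3` the anchor `E_ω³ × Ē_ω³` up to isogeny).
[cite: vanGeemen1994HodgeAV, 5.3] [cite: Deligne1982HodgeCycles, §4 Remark 4.10] -/
theorem exists_twistedCMCube (d : ℕ) (hd : 0 < d) :
    ∃ (E₀ : AbelianVariety ℂ) (φT : E₀.powSucc 2 ⟶ E₀.powSucc 2),
      E₀.dim = 1 ∧ (E₀.powSucc 2).dim = 2 + 1 ∧ φT ≫ φT = -(d • 𝟙 (E₀.powSucc 2)) :=
  exists_ellipticPower_sq_eq_neg d hd 2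

/-- **`PureWeilSeedOnTwistedSquare C d ⟹ GoodAnchorPerClassAt C d`**: on the twisted square `(T × T, Φ)` the
weight-`1` Segre class is split, hence some `h(e′, a′)` is hyperbolic; a non-split class `δ` of sign `(−1)³` is
`[−m]` for a positive integer `m`, realised by the weight-`m` Segre class `h(e, a)`
(`exists_hasWeilDiscriminantNondeg_twistedSquare`: `[(−m)³] = [−m]`); the pure-Weil seed is a BF sheaf seed at
that `h(e, a)` (at every class, in fact). Verbatim the anchor bookkeeping of `doublyPolarisedSimilarAnchors_holds`.
[cite: vanGeemen1994HodgeAV, 4.14, Lemma 5.2 (2)–(4), 5.3–5.4] [cite: BuchweitzFlenner2003, §5 Thm. 5.1] -/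
theorem goodAnchorPerClassAt_of_pureWeilSeedOnTwistedSquare (C : ChernCharacterBetti) {d : ℕ} (hd : 0 < d)
    (h : PureWeilSeedOnTwistedSquare C d) : GoodAnchorPerClassAt C d := by
  obtain ⟨T, φT, w₀, hT, hφT, hw₀, hw₀Q, hw₀0, hseed⟩ := h
  intro δ hsign hne
  have n3 : (0 : ℕ) < 3 := by norm_num
  -- `δ = [-m]` for a positive integer `m`
  obtain ⟨q, rfl⟩ := QuotientGroup.mk_surjective δ
  have hq : (q : ℚ) < 0 := by
    rw [weilSign_mk] at hsign
    have h3 : ((-1 : ℤˣ) ^ 3) = -1 := Odd.neg_one_pow ⟨1, by norm_num⟩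
    exact (ratSign_eq_neg_one_iff q).1 (hsign.trans h3)
  obtain ⟨m, hm, hmq⟩ := exists_nat_mk_neg_eq (d := d) q hq
  -- the twisted square `(T × T, Φ = φ × (-φ))` is a `(3, d)` Weil sixfold
  have hPdim : (T.prod T).dim = 2 * 3 := dim_twistedSquare hT
  have hΦ := twistedSquare_comp_self hφT
  have hWP : IsWeilType (T.prod T)
      (AbelianVariety.prodLift (AbelianVariety.fst T T ≫ φT) (AbelianVariety.snd T T ≫ (-φT))) 3 d :=
    isWeilType_twistedSquare n3 hT hd hφT
  obtain ⟨eT, aT, haT, haT0, hfam⟩ :=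
    exists_hasWeilDiscriminantNondeg_twistedSquare (m₀ := 2) (by norm_num) hT hd hφT
  -- weight `1`: split class, a hyperbolic `h(e', a')`
  obtain ⟨e₁, a₁, w₁, ha₁, ha₁0, hw₁, -, hN₁⟩ := hfam 1 one_pos
  have hw₁' : w₁ = (-1 : ℚˣ) ^ 3 := by
    ext
    rw [hw₁]
    push_cast
    norm_num
  rw [hw₁'] at hN₁
  obtain ⟨-, e', a', ha', ha'0, hhyp⟩ :=
    Literature.AlgebraicGeometry.VanGeemen1994.IsWeilType.isSplitWeilType_of_hasWeilDiscriminantNondeg_split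
      hWP e₁ ha₁ ha₁0 hN₁
  -- weight `m`: class `[(-m)³] = [-m] = δ`
  obtain ⟨e, a, w, ha, ha0, hw, -, hN⟩ := hfam m hm
  have hwm : w = (-Units.mk0 (m : ℚ) (Nat.cast_ne_zero.2 hm.ne')) ^ (2 * 1 + 1) := by
    ext
    rw [hw]
    simp only [Units.val_pow_eq_pow_val, Units.val_neg, Units.val_mk0]
  have hwδ : (QuotientGroup.mk w : weilNormResidueGroup d) = QuotientGroup.mk q := by
    rw [hwm, weilNormResidueGroup_mk_pow_odd, hmq]
  rw [hwδ] at hN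
  have hw₀H := hWP.isOfHodgeType_of_mem_weilClassesOf hw₀
  exact ⟨T.prod T, AbelianVariety.prodLift (AbelianVariety.fst T T ≫ φT) (AbelianVariety.snd T T ≫ (-φT)),
    e, e', a, a', w₀, hPdim, hΦ, ha, ha0, ha', ha'0, hw₀, hw₀Q, hw₀0, hw₀H, hhyp, hN,
    fun _ => hasBFSheafSeedAt_of_hasPureWeilSeedAt C (T.prod T) w₀ hseed _⟩

/-- **ONE object decides the whole `d`-slice of K2ᵀ**: a pure-Weil semiregular seed on one twisted square per
twist-normalised Kleiman `C` gives the rung `KleimanAnchorRungCM d` (all non-split `√−d` cells at once).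
[cite: BuchweitzFlenner2003, §5 Thm. 5.1] [cite: vanGeemen1994HodgeAV, 5.3–5.4] -/
theorem kleimanAnchorRungCM_of_pureWeilSeedOnTwistedSquare {d : ℕ}
    (h : ∀ C : ChernCharacterBetti, C.IsTwistNormalised → C.KleimanChernNormalForm →
      PureWeilSeedOnTwistedSquare C d) :
    KleimanAnchorRungCM d :=
  fun C hT hK hd => memberwiseAt_of_goodAnchorPerClassAt C hd
    (goodAnchorPerClassAt_of_pureWeilSeedOnTwistedSquare C hd (h C hT hK))

/-- … and one such seed per `d` gives the registered stub statement. [cite: BuchweitzFlenner2003, §5 Thm. 5.1] -/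
theorem goodAnchorPerDiscriminantClassT_of_pureWeilSeedOnTwistedSquare
    (h : ∀ C : ChernCharacterBetti, C.IsTwistNormalised → C.KleimanChernNormalForm → ∀ d : ℕ, 0 < d →
      PureWeilSeedOnTwistedSquare C d) :
    GoodAnchorPerDiscriminantClassT :=
  fun C hT hK d hd => goodAnchorPerClassAt_of_pureWeilSeedOnTwistedSquare C hd (h C hT hK d hd)

/-! ### §3 The stubs -/

/-- **STUB `stub_good`** (OPEN, LOAD-BEARING; registered signature `GoodAnchorPerDiscriminantClassT`): the ∃-core
of K2ᵀ — for every twist-normalised Kleiman `C`, every `d ≥ 1` and every non-split `√−d` cell, ONE doubly-polarised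
`(3, d)` anchor in the cell at which class designs upgrade to Buchweitz–Flenner sheaf seeds. Why plausibly true:
the anchor may be CHOSEN in the cell (divisor-generated anchors — CM / product / `E`-power twisted squares, where
`w ∈ ℚ[NS]` and C-evaluable sheaves can reach the design class — exist in every cell, X2), and BF-semiregularity is
generic smoothness of the semiuniversal deformation; why it might fail: at every such anchor every C-evaluable
sheaf realising the design could have `σ` non-injective (targets `225` / `495`), cf. the H2 census negatives at
`E`-power anchors (first-order designs: THEOREM X∞, FCONE₅, W1; sums / box products never semiregular in the
Weil direction, STRATEGY-CENSUS of stmt-2524 T2). Size: XL (open research). Sufficient (proved above): one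
pure-Weil semiregular seed on one twisted square per `(C, d)`
(`goodAnchorPerDiscriminantClassT_of_pureWeilSeedOnTwistedSquare`). [cite: BuchweitzFlenner2003, §5 Thm. 5.1]
[cite: vanGeemen1994HodgeAV, 5.3–5.4] [cite: Fulton1998, Example 15.3.2] -/
theorem stub_good : GoodAnchorPerDiscriminantClassT := by
  sorry

/-- **STUB `stub_rung_CMclass_d3`** (T3 PLAN-ONLY FIRST RUNG, BC5; R13.61 (ii) / J r1 recipe; registered
signature `KleimanAnchorRungCM 3`): K2ᵀ for the discriminant `d = 3` — every non-hyperbolic `ℚ(√−3)` Weil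
sixfold member (each Weil-similar to the CM anchor `(E_ω³ × Ē_ω³, h_b)`, `b ∉ Nm ℚ(ω)ˣ`, of its cell) has a
doubly-polarised anchor with the design ⟹ seed upgrade. Implied by the crux (`rung_of_twistNormalisedKleimanSemiregularAnchor`)
and by `stub_good` (`kleimanAnchorRungCM_of_goodAnchorPerDiscriminantClassT · 3`); it is its own stub because it
is the route's first RUNG. TECHNIQUE (decision = ONE written object, two admissible shapes): (T-a) CELL-UNIFORM —
ONE finite locally free sheaf `E` on ONE twisted square `T × T` with `φ_T² = −3` (first candidate the CM sixfold
`E_ω³ × Ē_ω³`, whose Hodge ring is divisor-generated, so resolution-built sheaves — Serre twists along Segre maps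
and their syzygies, hence C-evaluable for EVERY twist-normalised `C` by
`IsTwistNormalised.exists_ch_serreTwist_one_eq_smul_map` + additivity — can have `ch₃ ∈ ℚ[NS] ∋ w`) with
PURE-WEIL `ch₃(E) = N·w`, `N ≠ 0`, `chₚ(E) = 0` for `p ∈ I ∖ {3}` and `σ_I` injective (`I = {3}`: `σ₂ : Ext²(E,E)
→ H⁴(Ω²)`, target `225`), i.e. `PureWeilSeedOnTwistedSquare C 3`; then `kleimanAnchorRungCM_of_pureWeilSeedOnTwistedSquare`
closes the rung for ALL non-split ℚ(√−3) cells at once; (T-b) CELL-WISE — at the CM anchor with `h = h_b` fixed, one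
resolution-built bundle whose character lies in §B's Schur-admissible list 𝓛 (HOME/SECTION-B-Kleiman.md §B.7
rev 5: first candidate the `r = 6` floor `(2,4,7; c₄ = 6e₄) + w_im`, or a j303592 survivor) with `σ₀ ⊕ σ₁ ⊕ σ₂`
injective (`I = {1,2,3}`, target `15 + 120 + 225`), giving `GoodAnchorInCellAt C 3 [−b]` cell by cell.
INSTRUMENT ROW that refutes/calibrates the key lemma (J T3 recipe, R13.61 (α)): at `E_ω³ × Ē_ω³`, `d = 3`, on the
written object — rank of `σ` on `Ext²(E,E)` (injective = HIT ⇒ land `KleimanAnchorRungCM 3` under Theorems by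
name ⇒ T3 PRESENT), `dim Ext²(E,E)` against `225` / `495`, rank of `ev_E` (Markman, arXiv:2509.23403 Lemma 11.3,
p. 18); a failure at one anchor / one object informs only (the rung is ∃-anchor: `T = B` a `(2,1)` threefold is
the next twisted square). WHY OUTSIDE S's KNOWN REGIME: algebraicity of Weil classes on non-split ℚ(√−3) sixfold
cells is open in print (Schoen 1998 Addendum = split ℚ(√−3); Koike = split ℚ(i); Markman arXiv:1805.11574 /
2509.23403 p. 3 = hyperbolic = split cells, all K; Mostaed arXiv:2603.20268 §1), while the rung asserts BF-openness
data along the non-split `h_b`-cells. Size: L (one object-level Ext computation on a CM abelian sixfold) to XL.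
[cite: BuchweitzFlenner2003, §5 Thm. 5.1] [cite: vanGeemen1994HodgeAV, 5.3–5.4]
[cite: Markman2025SurveySecant, Lemma 11.3] [cite: Fulton1998, Example 15.3.2] -/
theorem stub_rung_CMclass_d3 : KleimanAnchorRungCM 3 := by
  sorry

/-! ### §4 Composition: the stub gives the crux BY NAME -/

/-- **Composition** (kernel-checked; `sorry`-cone = `stub_good` only): `stub_good` gives the crux
`TwistNormalisedKleimanSemiregularAnchor` BY NAME, by pointwise Landherr (§1) — interchangeably,
`fun C hT hK => Theorems.kleimanSemiregularAnchorAt_of_goodAnchorPerDiscriminantClassAt C (fun d δ hd => stub_good C hT hK d hd δ)`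
(p811808). The rung stub is NOT in this cone (it is a consequence of the crux, `rung_of_…`).
[cite: vanGeemen1994HodgeAV, 4.14, Lemma 5.2, 5.3–5.4] [cite: Landherr1936HermitianForms] -/
theorem TwistNormalisedKleimanSemiregularAnchor_of :
    Summit.HodgeConjecture.HodgeConjecture.Theses.KleimanBFSeeds.TwistNormalisedKleimanSemiregularAnchor := by
  have hgood : GoodAnchorPerDiscriminantClassT := stub_good
  intro C hT hK d hd
  exact memberwiseAt_of_goodAnchorPerClassAt C hd (hgood C hT hK d hd)

/-- Cross-check against the landed certificate p811808 (same cone): the crux from `stub_good` through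
`Theorems.kleimanSemiregularAnchorAt_of_goodAnchorPerDiscriminantClassAt`. [cite: vanGeemen1994HodgeAV, 5.3–5.4] -/
theorem twistNormalisedKleimanSemiregularAnchor_of_stub_good_via_p811808 (h : GoodAnchorPerDiscriminantClassT) :
    Summit.HodgeConjecture.HodgeConjecture.Theses.KleimanBFSeeds.TwistNormalisedKleimanSemiregularAnchor :=
  fun C hT hK =>
    Summit.HodgeConjecture.HodgeConjecture.Theorems.kleimanSemiregularAnchorAt_of_goodAnchorPerDiscriminantClassAt C
      (fun d δ hd hs hne => h C hT hK d hd δ hs hne)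

end Summit.HodgeConjecture.HodgeConjecture.Cruxes.TwistNormalisedKleimanSemiregularAnchor.ChosenAnchor

end
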